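import Mathlib.Analysis.InnerProductSpace.PiL2
import Mathlib.Analysis.Normed.Module.Convex

/-!
# SmoothPoincare4 / SullivanDual — crux `Target` (stmt-SmoothPoincare4-7823), line `Sketch`:
# flat geometry helper `helper_isPreconnected_ball_diff_plane`

In the Mayer–Vietoris computation of `H²_dR` of a punctured chart `4`-ball, the deepest
intersection is an open ball of `EuclideanSpace ℝ (Fin 4)` minus the codimension-`2` affine plane
`{y | (y - c) 0 = 0 ∧ (y - c) 1 = 0}` through its centre.  All that is needed downstream is that
this set is preconnected (so that closed `0`-forms on it are constant).

Proof: the set is the union of the four CONVEX (hence preconnected) open half-balls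
`{y ∈ ball c r | c 0 < y 0}`, `{y ∈ ball c r | c 1 < y 1}`, `{y ∈ ball c r | y 0 < c 0}`,
`{y ∈ ball c r | y 1 < c 1}`, chained through the common points `c ± (r/4) e₀ ± (r/4) e₁`.
-/

noncomputable section

-- the registered namespace `Summit.SmoothPoincare4.SmoothPoincare4.Theorems` repeats a component
set_option linter.dupNamespace false

open Set Metric

namespace Summit.SmoothPoincare4.SmoothPoincare4.Theorems

namespace SullivanDual

/-- A coordinate functional `y ↦ y i` on `EuclideanSpace ℝ (Fin 4)` is linear. [folklore] -/
private theorem isLinearMap_coord (i : Fin 4) :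
    IsLinearMap ℝ (fun y : EuclideanSpace ℝ (Fin 4) => y i) :=
  IsLinearMap.mk (fun _ _ => rfl) (fun _ _ => rfl)

/-- The open half-ball `{y ∈ ball c r | a < y i}` is convex. [folklore] -/
private theorem convex_ball_inter_coord_gt (c : EuclideanSpace ℝ (Fin 4)) (r : ℝ) (i : Fin 4)
    (a : ℝ) : Convex ℝ {y : EuclideanSpace ℝ (Fin 4) | y ∈ Metric.ball c r ∧ a < y i} :=
  (convex_ball c r).inter (convex_halfSpace_gt (isLinearMap_coord i) a)

/-- The open half-ball `{y ∈ ball c r | y i < a}` is convex. [folklore] -/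
private theorem convex_ball_inter_coord_lt (c : EuclideanSpace ℝ (Fin 4)) (r : ℝ) (i : Fin 4)
    (a : ℝ) : Convex ℝ {y : EuclideanSpace ℝ (Fin 4) | y ∈ Metric.ball c r ∧ y i < a} :=
  (convex_ball c r).inter (convex_halfSpace_lt (isLinearMap_coord i) a)

/-- The point `c + a e₀ + b e₁` with `|a| + |b| < r` lies in `ball c r`. [folklore] -/
private theorem mem_ball_of_two_coords (c : EuclideanSpace ℝ (Fin 4)) {r : ℝ} (a b : ℝ)
    (hab : |a| + |b| < r) :
    c + (EuclideanSpace.single 0 a + EuclideanSpace.single 1 b) ∈ Metric.ball c r := by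
  rw [Metric.mem_ball, dist_eq_norm, add_sub_cancel_left]
  calc ‖EuclideanSpace.single (0 : Fin 4) a + EuclideanSpace.single (1 : Fin 4) b‖
      ≤ ‖EuclideanSpace.single (0 : Fin 4) a‖ + ‖EuclideanSpace.single (1 : Fin 4) b‖ :=
        norm_add_le _ _
    _ = |a| + |b| := by
        rw [PiLp.norm_single, PiLp.norm_single, Real.norm_eq_abs, Real.norm_eq_abs]
    _ < r := hab

/-- The `0`-th coordinate of `c + a e₀ + b e₁` is `c 0 + a`. [folklore] -/
private theorem two_coords_apply_zero (c : EuclideanSpace ℝ (Fin 4)) (a b : ℝ) :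
    (c + (EuclideanSpace.single 0 a + EuclideanSpace.single 1 b) : EuclideanSpace ℝ (Fin 4)) 0 =
      c 0 + a := by
  have h : (0 : Fin 4) ≠ 1 := by decide
  simp [h]

/-- The `1`-st coordinate of `c + a e₀ + b e₁` is `c 1 + b`. [folklore] -/
private theorem two_coords_apply_one (c : EuclideanSpace ℝ (Fin 4)) (a b : ℝ) :
    (c + (EuclideanSpace.single 0 a + EuclideanSpace.single 1 b) : EuclideanSpace ℝ (Fin 4)) 1 =
      c 1 + b := by
  have h : (1 : Fin 4) ≠ 0 := by decide
  simp [h]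

/-- **An open `4`-ball minus the coordinate `2`-plane through its centre is preconnected.**
The set `{y ∈ ball c r | (y - c) 0 ≠ 0 ∨ (y - c) 1 ≠ 0}` is the union of four convex open
half-balls, consecutive ones sharing a point `c ± (r/4) e₀ ± (r/4) e₁`. [folklore] -/
theorem helper_isPreconnected_ball_diff_plane (c : EuclideanSpace ℝ (Fin 4)) {r : ℝ} (hr : 0 < r) :
    IsPreconnected {y : EuclideanSpace ℝ (Fin 4) | y ∈ Metric.ball c r ∧
      ((y - c) 0 ≠ 0 ∨ (y - c) 1 ≠ 0)} := by
  -- the four convex pieces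
  have hS : {y : EuclideanSpace ℝ (Fin 4) | y ∈ Metric.ball c r ∧
      ((y - c) 0 ≠ 0 ∨ (y - c) 1 ≠ 0)} =
      (({y : EuclideanSpace ℝ (Fin 4) | y ∈ Metric.ball c r ∧ c 0 < y 0} ∪
        {y : EuclideanSpace ℝ (Fin 4) | y ∈ Metric.ball c r ∧ c 1 < y 1}) ∪
        {y : EuclideanSpace ℝ (Fin 4) | y ∈ Metric.ball c r ∧ y 0 < c 0}) ∪
        {y : EuclideanSpace ℝ (Fin 4) | y ∈ Metric.ball c r ∧ y 1 < c 1} := by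
    ext y
    simp only [mem_setOf_eq, mem_union, PiLp.sub_apply, sub_ne_zero]
    simp only [ne_iff_lt_or_gt]
    tauto
  rw [hS]
  -- quarter-radius offsets along `e₀`, `e₁`
  have hq : |r / 4| + |r / 4| < r := by
    rw [abs_of_pos (by positivity)]
    linarith
  have hq' : |-(r / 4)| + |r / 4| < r := by rwa [abs_neg]
  have hq'' : |r / 4| + |-(r / 4)| < r := by rwa [abs_neg, add_comm]
  have h4 : 0 < r / 4 := by positivity
  refine IsPreconnected.union (c + (EuclideanSpace.single 0 (r / 4) +
      EuclideanSpace.single 1 (-(r / 4)))) ?_ ?_ (IsPreconnected.union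
      (c + (EuclideanSpace.single 0 (-(r / 4)) + EuclideanSpace.single 1 (r / 4))) ?_ ?_
      (IsPreconnected.union
        (c + (EuclideanSpace.single 0 (r / 4) + EuclideanSpace.single 1 (r / 4))) ?_ ?_
        (convex_ball_inter_coord_gt c r 0 (c 0)).isPreconnected
        (convex_ball_inter_coord_gt c r 1 (c 1)).isPreconnected)
      (convex_ball_inter_coord_lt c r 0 (c 0)).isPreconnected)
    (convex_ball_inter_coord_lt c r 1 (c 1)).isPreconnected
  · -- `c + (r/4) e₀ - (r/4) e₁ ∈ U₀⁺ ⊆ (U₀⁺ ∪ U₁⁺) ∪ U₀⁻`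
    refine Or.inl (Or.inl ⟨mem_ball_of_two_coords c _ _ hq'', ?_⟩)
    rw [two_coords_apply_zero]
    linarith
  · -- `c + (r/4) e₀ - (r/4) e₁ ∈ U₁⁻`
    refine ⟨mem_ball_of_two_coords c _ _ hq'', ?_⟩
    rw [two_coords_apply_one]
    linarith
  · -- `c - (r/4) e₀ + (r/4) e₁ ∈ U₁⁺ ⊆ U₀⁺ ∪ U₁⁺`
    refine Or.inr ⟨mem_ball_of_two_coords c _ _ hq', ?_⟩
    rw [two_coords_apply_one]
    linarith
  · -- `c - (r/4) e₀ + (r/4) e₁ ∈ U₀⁻`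
    refine ⟨mem_ball_of_two_coords c _ _ hq', ?_⟩
    rw [two_coords_apply_zero]
    linarith
  · -- `c + (r/4) e₀ + (r/4) e₁ ∈ U₀⁺`
    refine ⟨mem_ball_of_two_coords c _ _ hq, ?_⟩
    rw [two_coords_apply_zero]
    linarith
  · -- `c + (r/4) e₀ + (r/4) e₁ ∈ U₁⁺`
    refine ⟨mem_ball_of_two_coords c _ _ hq, ?_⟩
    rw [two_coords_apply_one]
    linarith

end SullivanDual

end Summit.SmoothPoincare4.SmoothPoincare4.Theorems

end
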